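import Literature.Computability.FineGrained.SchoeningCoinRoutines
import HarnessLib

/-!
# Schöning's random-walk algorithm for `k`-SAT, machine III: scanning the formula for a violated clause

Topic `Literature/Computability/FineGrained`; machine half of the line `SchoeningCoin*` towards the
named fact `Literature.Computability.FineGrained.schoening` (Schöning, FOCS 1999, Theorem),
continuing `SchoeningCoinRoutines.lean` (register file `MSt`/`st`, `pick`, `initPass`). One step
of the walk first *scans* the formula under the current assignment: `scan` reads a copy of the
formula word; the bits of a literal are collected in the probe `pr` (reversed, the polarity ending
on top), at its comma the value of its variable is looked up in the assignment `vt` by the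
toolkit's `IPRenameM.lookupVal` and the literal is staged, with its value flipped, in `clR`
(`litEnd`); at the `ket` of a clause (`clauseEnd`) a satisfied clause drops its staging, and the
first violated clause is moved to `cl` and the flag `fl` raised. The specification `runs_scan`
says: `fl := flag (viol φ L.val).isSome`, `cl := staged (viol φ L.val)` (`SchoeningCoin.viol`:
the first clause all of whose literals are false), everything else unchanged, within an explicit
polynomial budget.

## References

* U. Schöning, *A probabilistic algorithm for k-SAT and constraint satisfaction problems*, Proc.
  40th FOCS (1999) 410–414 (the algorithm: "choose a clause C not satisfied by the current
  assignment") [key `SchoeningFOCS1999`].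
* T. Nipkow, G. Klein, *Concrete Semantics with Isabelle/HOL*, Springer 2014, Ch. 7 (big-step
  reasoning about loops, as in `SymbolPrograms.lean`).
-/

namespace Literature.Computability.FineGrained.SchoeningCoin

open _root_.Computability Complexity Complexity.ACom IPRenameM Sparsifier

variable {k : ℕ}

/-! ### Functional model of the scan -/

/-- A literal is satisfied under the literal list `L`. [folklore] -/
def satL (L : List Lit) (l : ℕ × Bool) : Bool := Asg.val L l.1 == l.2

/-- A clause is violated under `L`: all its literals are false. [folklore] -/
def violC (L : List Lit) (c : List (ℕ × Bool)) : Bool := c.all fun l => !satL L l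

/-- `viol` is the first violated clause. [folklore] -/
theorem viol_eq_find (φ : KCNF k) (L : List Lit) : viol φ (Asg.val L) = φ.clauses.find? (violC L) := rfl

/-- A clause is violated iff none of its literals is satisfied. [folklore] -/
theorem violC_eq (L : List Lit) (c : List (ℕ × Bool)) : violC L c = !c.any (satL L) := by
  simp [violC, List.all_eq_not_any_not]

/-- The staging of a (violated) clause in `cl`: its entries, each closed by `blank`. [folklore] -/
def stagedW (L : List Lit) : Option (List (ℕ × Bool)) → List Γ'
  | none => []
  | some C => wEntries Γ'.blank (C.map (entryW L))

/-! ### Programs -/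

/-- At the comma of a literal: pop its polarity `p` off the probe, look the variable up
(`lookupVal`: `val := flag (value = true)`), record "literal satisfied" (`value = p`) in the clause
flag `res`, and stage the entry of the literal with its value flipped on `clR` (comma, index bits
poured from `pr`, flipped value, `blank`). [folklore] -/
def litEnd : RProg :=
  pop (kr KR.pr) fun o => match o with
    | some (Γ'.bit p) => lookupVal ;; pop (kr KR.val) fun v =>
        (if v.isSome = p then setFlagG Γ'.blank (kr KR.res) else skip) ;;
        push (kr KR.cl) Γ'.comma ;; pour (kr KR.pr) (kr KR.cl) ;;
        push (kr KR.cl) (Γ'.bit (!v.isSome)) ;; push (kr KR.cl) Γ'.blank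
    | _ => skip

/-- At the `ket` of a clause: a satisfied clause (flag `res` up) drops its staging; a violated one
is moved to `cl` and raises `fl`, unless a violated clause was found before. [folklore] -/
def clauseEnd : RProg :=
  pop (kr KR.res) fun o => match o with
    | some _ => clear (kr KR.cl)
    | none => ifTop (kr KR.fl) fun o' => match o' with
        | some _ => clear (kr KR.cl)
        | none => pour (kr KR.cl) (kr KR.clw) ;; push (kr KR.fl) Γ'.blank

/-- Body of the scan over the formula copy. [folklore] -/
def scanBody (a : Γ') : RProg :=
  match a with
  | Γ'.bit b => push (kr KR.pr) (Γ'.bit b)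
  | Γ'.comma => litEnd
  | Γ'.ket => clauseEnd
  | _ => skip

/-- `scan`: find the first clause violated by the assignment in `vt`, over a copy of the formula.
[cite: SchoeningFOCS1999, Theorem (the algorithm: "let C be a clause not satisfied by the assignment")] -/
def scan : RProg :=
  copyToG (kr KR.fam) (kr KR.fam2) (kr KR.t1) (kr KR.t2) ;; loop (kr KR.fam2) scanBody

/-! ### The scan, literal by literal -/

/-- The bits of a literal go to the probe. [folklore] -/
theorem segRuns_scan_bits (ρ : MSt) : ∀ (bs : List Γ') (_ : ∀ a ∈ bs, ∃ b, a = Γ'.bit b) (pr₀ rest : List Γ'),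
    SegRuns (kr KR.fam2) scanBody bs (st { ρ with fam2 := bs ++ rest, pr := pr₀ })
      (st { ρ with fam2 := rest, pr := bs.reverse ++ pr₀ }) (3 * bs.length)
  | [], _, pr₀, rest => by simpa using SegRuns.nil (kr KR.fam2) scanBody _
  | a :: bs, hbs, pr₀, rest => by
    obtain ⟨b, rfl⟩ := hbs a (by simp)
    have h1 : Runs (scanBody (Γ'.bit b)) (st { ρ with fam2 := bs ++ rest, pr := pr₀ })
        (st { ρ with fam2 := bs ++ rest, pr := Γ'.bit b :: pr₀ }) 1 :=
      (Runs.push (kr KR.pr) (Γ'.bit b) _).of_eq (by simp) le_rfl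
    have h2 := segRuns_scan_bits ρ bs (fun a ha => hbs a (by simp [ha])) (Γ'.bit b :: pr₀) rest
    refine (SegRuns.cons' (st_fam2 _) (by simp) h1 h2).of_eq (by simp) ?_
    simp only [List.length_cons]; omega

/-- **The comma of a literal** (`litEnd`), with the polarity and the reversed index in the probe.
[folklore] -/
theorem runs_litEnd (ρ : MSt) (L : List Lit) (l : ℕ × Bool) (P : Prop) [Decidable P] (X rest : List Γ') :
    Runs (scanBody Γ'.comma)
      (st { ρ with
        fam2 := rest, pr := Γ'.bit l.2 :: rbits l.1, val := [], res := flagW Γ'.blank P, clR := X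
        vt := cbody L, t1 := [], t2 := [] })
      (st { ρ with
        fam2 := rest, pr := [], val := [], res := flagW Γ'.blank (P ∨ satL L l = true)
        clR := (entryW L l ++ [Γ'.blank]).reverse ++ X, vt := cbody L, t1 := [], t2 := [] })
      ((12 * (rbits l.1).length + 46) * (cbody L).length + 3 * (rbits l.1).length + 23) := by
  show Runs litEnd _ _ _
  unfold litEnd
  rw [show (12 * (rbits l.1).length + 46) * (cbody L).length + 3 * (rbits l.1).length + 23 =
    ((12 * (rbits l.1).length + 46) * (cbody L).length + 10 + (3 * (rbits l.1).length + 11)) + 2 by ring]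
  refine Runs.pop_cons (st_pr _) ?_
  simp only [update_st_pr]
  -- the lookup
  have hlk := runs_lookupVal
    (st { ρ with
      fam2 := rest, pr := rbits l.1, val := [], res := flagW Γ'.blank P, clR := X, vt := cbody L, t1 := [], t2 := [] })
    l.1 L (by simp) (by simp) (by simp) (by simp) (by simp) (by simp) (by simp) (by simp) (by simp) (by simp)
    (by simp) (by simp)
  simp only [update_st_val] at hlk
  refine hlk.seq ?_
  -- the value flag, the clause flag, the staging
  have hrest : ∀ (v : Bool),
      Runs ((if v = l.2 then setFlagG Γ'.blank (kr KR.res) else skip) ;;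
          push (kr KR.cl) Γ'.comma ;; pour (kr KR.pr) (kr KR.cl) ;;
          push (kr KR.cl) (Γ'.bit (!v)) ;; push (kr KR.cl) Γ'.blank)
        (st { ρ with
          fam2 := rest, pr := rbits l.1, val := [], res := flagW Γ'.blank P, clR := X, vt := cbody L
          t1 := [], t2 := [] })
        (st { ρ with
          fam2 := rest, pr := [], val := [], res := flagW Γ'.blank (P ∨ v = l.2)
          clR := Γ'.blank :: Γ'.bit (!v) :: ((rbits l.1).reverse ++ Γ'.comma :: X), vt := cbody L
          t1 := [], t2 := [] })
        (3 * (rbits l.1).length + 9) := by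
    intro v
    have h1 : Runs (if v = l.2 then setFlagG Γ'.blank (kr KR.res) else skip)
        (st { ρ with
          fam2 := rest, pr := rbits l.1, val := [], res := flagW Γ'.blank P, clR := X, vt := cbody L
          t1 := [], t2 := [] })
        (st { ρ with
          fam2 := rest, pr := rbits l.1, val := [], res := flagW Γ'.blank (P ∨ v = l.2), clR := X, vt := cbody L
          t1 := [], t2 := [] }) 4 := by
      by_cases hv : v = l.2
      · rw [if_pos hv]
        refine (runs_setFlagG Γ'.blank (kr KR.res) _ (by simp [length_flagW_le])).of_eq ?_ le_rfl
        rw [update_st_res, flagW_true _ (Or.inr hv)]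
      · rw [if_neg hv, flagW_congr Γ'.blank (show (P ∨ v = l.2) ↔ P by simp [hv])]
        exact (Runs.skip _).mono (by omega)
    have h2 := Runs.push (kr KR.cl) Γ'.comma
      (st { ρ with
        fam2 := rest, pr := rbits l.1, val := [], res := flagW Γ'.blank (P ∨ v = l.2), clR := X, vt := cbody L
        t1 := [], t2 := [] })
    simp only [st_clR, update_st_clR] at h2
    have h3 := runs_pour (a := kr KR.pr) (b := kr KR.cl) (by decide)
      (st { ρ with
        fam2 := rest, pr := rbits l.1, val := [], res := flagW Γ'.blank (P ∨ v = l.2), clR := Γ'.comma :: X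
        vt := cbody L, t1 := [], t2 := [] })
    simp only [st_pr, st_clR, update_st_pr, update_st_clR] at h3
    have h4 := Runs.push (kr KR.cl) (Γ'.bit (!v))
      (st { ρ with
        fam2 := rest, pr := [], val := [], res := flagW Γ'.blank (P ∨ v = l.2)
        clR := (rbits l.1).reverse ++ Γ'.comma :: X, vt := cbody L, t1 := [], t2 := [] })
    simp only [st_clR, update_st_clR] at h4
    have h5 := Runs.push (kr KR.cl) Γ'.blank
      (st { ρ with
        fam2 := rest, pr := [], val := [], res := flagW Γ'.blank (P ∨ v = l.2)
        clR := Γ'.bit (!v) :: ((rbits l.1).reverse ++ Γ'.comma :: X), vt := cbody L, t1 := [], t2 := [] })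
    simp only [st_clR, update_st_clR] at h5
    exact (h1.seq (h2.seq (h3.seq (h4.seq h5)))).of_eq rfl (by omega)
  have hentry : ∀ v : Bool, (Asg.val L l.1 = v) →
      Γ'.blank :: Γ'.bit (!v) :: ((rbits l.1).reverse ++ Γ'.comma :: X) = (entryW L l ++ [Γ'.blank]).reverse ++ X := by
    intro v hv; simp [entryW, hv]
  by_cases hval : lookupB L l.1 = true
  · have hval' : Asg.val L l.1 = true := hval
    rw [flagW_true _ hval]
    refine Runs.pop_cons (st_val _) ?_
    simp only [update_st_val, Option.isSome_some]
    refine (hrest true).of_eq ?_ (by omega)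
    rw [hentry true hval', flagW_congr Γ'.blank (show (P ∨ true = l.2) ↔ (P ∨ satL L l = true) by simp [satL, hval'])]
  · have hval' : Asg.val L l.1 = false := by rw [← lookupB_eq_val]; simpa using hval
    rw [flagW_false _ hval]
    refine Runs.pop_nil (st_val _) ?_
    simp only [Option.isSome_none]
    refine (hrest false).of_eq ?_ (by omega)
    rw [hentry false hval', flagW_congr Γ'.blank (show (P ∨ false = l.2) ↔ (P ∨ satL L l = true) by simp [satL, hval'])]

/-- **One literal of the scan.** [folklore] -/
theorem segRuns_scan_lit (ρ : MSt) (L : List Lit) (l : ℕ × Bool) (P : Prop) [Decidable P] (X rest : List Γ') :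
    SegRuns (kr KR.fam2) scanBody (litW l)
      (st { ρ with
        fam2 := litW l ++ rest, pr := [], val := [], res := flagW Γ'.blank P, clR := X, vt := cbody L
        t1 := [], t2 := [] })
      (st { ρ with
        fam2 := rest, pr := [], val := [], res := flagW Γ'.blank (P ∨ satL L l = true)
        clR := (entryW L l ++ [Γ'.blank]).reverse ++ X, vt := cbody L, t1 := [], t2 := [] })
      ((12 * (rbits l.1).length + 46) * (cbody L).length + 6 * (rbits l.1).length + 28) := by
  have hb := segRuns_scan_bits
    { ρ with fam2 := [], pr := [], val := [], res := flagW Γ'.blank P, clR := X, vt := cbody L, t1 := [], t2 := [] }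
    ((encodeNat l.1).map Γ'.bit ++ [Γ'.bit l.2]) (by
      intro a ha; simp only [List.mem_append, List.mem_map, List.mem_singleton] at ha
      rcases ha with ⟨b, _, rfl⟩ | rfl <;> exact ⟨_, rfl⟩) [] (Γ'.comma :: rest)
  simp only [List.append_nil, reverse_bits_pol] at hb
  have hc := runs_litEnd ρ L l P X rest
  have hfin := hb.append (SegRuns.single (st_fam2 _) (by simpa only [update_st_fam2] using hc))
  simp only [litW, List.append_assoc, List.cons_append, List.nil_append] at hfin ⊢
  refine hfin.of_eq rfl ?_
  simp [rbits]; omega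

/-- **The literals of a clause in the scan**: the clause flag collects "some literal satisfied",
the staging collects the entries. [folklore] -/
theorem segRuns_scan_lits (ρ : MSt) (L : List Lit) (W : ℕ) : ∀ (c : List (ℕ × Bool))
    (_ : ∀ l ∈ c, (rbits l.1).length ≤ W) (P : Prop) [Decidable P] (X rest : List Γ'),
    SegRuns (kr KR.fam2) scanBody (c.flatMap litW)
      (st { ρ with
        fam2 := c.flatMap litW ++ rest, pr := [], val := [], res := flagW Γ'.blank P, clR := X, vt := cbody L
        t1 := [], t2 := [] })
      (st { ρ with
        fam2 := rest, pr := [], val := [], res := flagW Γ'.blank (P ∨ c.any (satL L) = true)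
        clR := (wEntries Γ'.blank (c.map (entryW L))).reverse ++ X, vt := cbody L, t1 := [], t2 := [] })
      (((12 * W + 46) * (cbody L).length + 6 * W + 28) * c.length)
  | [], _, P, _, X, rest => by
    simpa [wEntries, flagW_congr Γ'.blank (show (P ∨ False) ↔ P by simp)] using SegRuns.nil (kr KR.fam2) scanBody _
  | l :: c, hW, P, _, X, rest => by
    have hl := hW l (by simp)
    have h1 := segRuns_scan_lit ρ L l P X (c.flatMap litW ++ rest)
    have h2 := segRuns_scan_lits ρ L W c (fun l' hl' => hW l' (by simp [hl'])) (P ∨ satL L l = true)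
      ((entryW L l ++ [Γ'.blank]).reverse ++ X) rest
    rw [List.flatMap_cons, List.append_assoc]
    refine (h1.append h2).of_eq ?_ ?_
    · rw [flagW_congr Γ'.blank (show ((P ∨ satL L l = true) ∨ c.any (satL L) = true) ↔
          (P ∨ (l :: c).any (satL L) = true) by simp [or_assoc])]
      simp [wEntries]
    · have := Nat.mul_le_mul_right (cbody L).length (Nat.add_le_add_right (Nat.mul_le_mul_left 12 hl) 46)
      simp only [List.length_cons]
      nlinarith

/-! ### The scan, clause by clause -/

/-- **The `ket` of a clause** (`clauseEnd`). [folklore] -/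
theorem runs_clauseEnd (ρ : MSt) (L : List Lit) (c : List (ℕ × Bool)) (F : Option (List (ℕ × Bool)))
    (rest : List Γ') :
    Runs (scanBody Γ'.ket)
      (st { ρ with
        fam2 := rest, res := flagW Γ'.blank (c.any (satL L) = true)
        clR := (wEntries Γ'.blank (c.map (entryW L))).reverse, fl := flagW Γ'.blank (F.isSome = true)
        cl := stagedW L F })
      (st { ρ with
        fam2 := rest, res := [], clR := []
        fl := flagW Γ'.blank ((F.or (if violC L c then some c else none)).isSome = true)
        cl := stagedW L (F.or (if violC L c then some c else none)) })
      (3 * (wEntries Γ'.blank (c.map (entryW L))).length + 8) := by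
  show Runs clauseEnd _ _ _
  unfold clauseEnd
  set E := (wEntries Γ'.blank (c.map (entryW L))) with hE
  by_cases hsat : c.any (satL L) = true
  · -- satisfied: drop the staging
    have hv : violC L c = false := by rw [violC_eq, hsat]; rfl
    rw [flagW_true _ hsat, hv]
    simp only [Bool.false_eq_true, ite_false, Option.or_none]
    refine (Runs.pop_cons (st_res _) ((runs_clear (kr KR.cl) _).of_eq (by simp) le_rfl)).of_eq rfl ?_
    simp; omega
  · have hv : violC L c = true := by rw [violC_eq]; simpa using hsat
    rw [flagW_false _ hsat, hv]
    simp only [ite_true]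
    rw [show 3 * E.length + 8 = (3 * E.length + 6) + 2 by ring]
    refine Runs.pop_nil (st_res _) ?_
    cases F with
    | some C =>
      -- a violated clause was found before
      simp only [Option.isSome_some, Option.some_or]
      rw [flagW_true _ trivial]
      refine (Runs.ifTop_cons (st_fl _) ((runs_clear (kr KR.cl) _).of_eq (by simp) le_rfl)).of_eq rfl ?_
      simp; omega
    | none =>
      simp only [Option.isSome_none, Option.none_or, Option.isSome_some, Bool.false_eq_true]
      rw [flagW_false _ not_false, flagW_true _ trivial, show 3 * E.length + 6 = (3 * E.length + 4) + 2 by ring]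
      refine Runs.ifTop_nil (st_fl _) ?_
      have h1 := runs_pour (a := kr KR.cl) (b := kr KR.clw) (by decide)
        (st { ρ with fam2 := rest, res := [], clR := E.reverse, fl := [], cl := stagedW L none })
      simp only [st_clR, st_cl, stagedW, List.append_nil, List.reverse_reverse, update_st_clR, update_st_cl,
        List.length_reverse] at h1
      have h2 := Runs.push (kr KR.fl) Γ'.blank (st { ρ with fam2 := rest, res := [], clR := [], fl := [], cl := E })
      simp only [st_fl, update_st_fl] at h2
      exact (h1.seq h2).of_eq rfl (by omega)

/-- **One clause of the scan.** [folklore] -/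
theorem segRuns_scan_clause (ρ : MSt) (L : List Lit) (W : ℕ) (c : List (ℕ × Bool))
    (hW : ∀ l ∈ c, (rbits l.1).length ≤ W) (F : Option (List (ℕ × Bool))) (rest : List Γ') :
    SegRuns (kr KR.fam2) scanBody (clauseW c)
      (st { ρ with
        fam2 := clauseW c ++ rest, pr := [], val := [], res := [], clR := [], vt := cbody L, t1 := [], t2 := []
        fl := flagW Γ'.blank (F.isSome = true), cl := stagedW L F })
      (st { ρ with
        fam2 := rest, pr := [], val := [], res := [], clR := [], vt := cbody L, t1 := [], t2 := []
        fl := flagW Γ'.blank ((F.or (if violC L c then some c else none)).isSome = true)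
        cl := stagedW L (F.or (if violC L c then some c else none)) })
      (((12 * W + 46) * (cbody L).length + 6 * W + 28) * c.length + 6 * (clauseW c).length + 12) := by
  have h0 : Runs (scanBody Γ'.bra)
      (st { ρ with
        fam2 := c.flatMap litW ++ (Γ'.ket :: rest), pr := [], val := [], res := [], clR := [], vt := cbody L
        t1 := [], t2 := [], fl := flagW Γ'.blank (F.isSome = true), cl := stagedW L F })
      (st { ρ with
        fam2 := c.flatMap litW ++ (Γ'.ket :: rest), pr := [], val := [], res := [], clR := [], vt := cbody L
        t1 := [], t2 := [], fl := flagW Γ'.blank (F.isSome = true), cl := stagedW L F }) 0 := Runs.skip _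
  have h1 := segRuns_scan_lits
    { ρ with res := [], clR := [], fl := flagW Γ'.blank (F.isSome = true), cl := stagedW L F } L W c hW False []
    (Γ'.ket :: rest)
  simp only [flagW_false _ not_false, List.append_nil, false_or] at h1
  have h2 := runs_clauseEnd { ρ with pr := [], val := [], vt := cbody L, t1 := [], t2 := [] } L c F rest
  have hE : (wEntries Γ'.blank (c.map (entryW L))).length ≤ 2 * (clauseW c).length := by
    have : ∀ c' : List (ℕ × Bool),
        (wEntries Γ'.blank (c'.map (entryW L))).length ≤ 2 * (c'.flatMap litW).length := by
      intro c'
      induction c' with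
      | nil => simp [wEntries]
      | cons l c' ih =>
        rw [List.map_cons, wEntries_cons, List.flatMap_cons]
        simp only [List.length_append, List.length_cons] at ih ⊢
        have : (entryW L l).length + 1 ≤ 2 * (litW l).length := by simp [entryW, litW, rbits]
        omega
    refine (this c).trans ?_
    simp [clauseW]; omega
  unfold clauseW
  refine (SegRuns.cons' (st_fam2 _) (by simp) h0
    (h1.append (SegRuns.single (st_fam2 _) (by simpa only [update_st_fam2] using h2)))).of_eq rfl ?_
  simp only [clauseW, List.length_cons, List.length_append] at hE ⊢
  omega

/-- **The clauses of the scan**: the first violated clause is found (`List.find?`). [folklore] -/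
theorem segRuns_scan_clauses (ρ : MSt) (L : List Lit) (W : ℕ) : ∀ (cs : List (List (ℕ × Bool)))
    (_ : ∀ c ∈ cs, ∀ l ∈ c, (rbits l.1).length ≤ W) (F : Option (List (ℕ × Bool))) (rest : List Γ'),
    SegRuns (kr KR.fam2) scanBody (cs.flatMap clauseW)
      (st { ρ with
        fam2 := cs.flatMap clauseW ++ rest, pr := [], val := [], res := [], clR := [], vt := cbody L
        t1 := [], t2 := [], fl := flagW Γ'.blank (F.isSome = true), cl := stagedW L F })
      (st { ρ with
        fam2 := rest, pr := [], val := [], res := [], clR := [], vt := cbody L, t1 := [], t2 := []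
        fl := flagW Γ'.blank ((F.or (cs.find? (violC L))).isSome = true)
        cl := stagedW L (F.or (cs.find? (violC L))) })
      ((((12 * W + 46) * (cbody L).length + 6 * W + 28) + 18) * (cs.flatMap clauseW).length)
  | [], _, F, rest => by simpa using SegRuns.nil (kr KR.fam2) scanBody _
  | c :: cs, hW, F, rest => by
    have h1 := segRuns_scan_clause ρ L W c (hW c (by simp)) F (cs.flatMap clauseW ++ rest)
    have h2 := segRuns_scan_clauses ρ L W cs (fun c' hc' => hW c' (by simp [hc']))
      (F.or (if violC L c then some c else none)) rest
    rw [List.flatMap_cons, List.append_assoc]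
    refine (h1.append h2).of_eq ?_ ?_
    · rw [List.find?_cons, Option.or_assoc]
      cases violC L c <;> simp
    · have hc : c.length ≤ (clauseW c).length := by
        have : ∀ c' : List (ℕ × Bool), c'.length ≤ (c'.flatMap litW).length := by
          intro c'
          induction c' with
          | nil => simp
          | cons l c' ih =>
            rw [List.flatMap_cons, List.length_append, List.length_cons]
            have : 1 ≤ (litW l).length := by simp [litW]
            omega
        refine (this c).trans ?_
        simp [clauseW]; omega
      have hcw : 1 ≤ (clauseW c).length := by simp [clauseW]
      set K := (12 * W + 46) * (cbody L).length + 6 * W + 28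
      have hK := Nat.mul_le_mul_left K hc
      simp only [List.length_append]
      nlinarith [hK, hcw]

/-- The index bits of every literal are shorter than the formula word. [folklore] -/
theorem length_rbits_le (φ : KCNF k) {c : List (ℕ × Bool)} (hc : c ∈ φ.clauses) {l : ℕ × Bool} (hl : l ∈ c) :
    (rbits l.1).length ≤ (formW φ).length := by
  have h1 : (rbits l.1).length ≤ (litW l).length := by simp [rbits, litW]
  have h2 : (litW l).length ≤ (clauseW c).length := by
    have := Transcode.length_le_length_flatMap litW hl
    simp only [clauseW, List.length_cons, List.length_append]
    omega
  have h3 : (clauseW c).length ≤ (formW φ).length := Transcode.length_le_length_flatMap clauseW hc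
  omega


/-- The budget of one scan of a formula word of length `W` under an assignment word of length `V`.
[folklore] -/
def scanCost (W V : ℕ) : ℕ := (((12 * W + 46) * V + 6 * W + 28) + 18) * W + 10 * W + 4

/-- **Specification of `scan`**: with the formula `formW φ` in `fam` and the assignment `cbody L` in
`vt` (scratch registers empty), the flag `fl` is raised iff some clause is violated and then `cl`
holds the staging of the first violated clause `viol φ L.val`; nothing else changes.
[cite: SchoeningFOCS1999, Theorem (the algorithm: "let C be a clause not satisfied by the assignment")] -/
theorem runs_scan (φ : KCNF k) (ρ : MSt) (L : List Lit) :
    Runs scan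
      (st { ρ with
        fam := formW φ, fam2 := [], pr := [], val := [], res := [], clR := [], vt := cbody L, t1 := [], t2 := []
        fl := [], cl := [] })
      (st { ρ with
        fam := formW φ, fam2 := [], pr := [], val := [], res := [], clR := [], vt := cbody L, t1 := [], t2 := []
        fl := flagW Γ'.blank ((viol φ (Asg.val L)).isSome = true), cl := stagedW L (viol φ (Asg.val L)) })
      (scanCost (formW φ).length (cbody L).length) := by
  unfold scan scanCost
  have h1 := runs_copyToG (a := kr KR.fam) (b := kr KR.fam2) (t₁ := kr KR.t1) (t₂ := kr KR.t2)
    (by decide) (by decide) (by decide) (by decide) (by decide) (by decide)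
    (st { ρ with
      fam := formW φ, fam2 := [], pr := [], val := [], res := [], clR := [], vt := cbody L, t1 := [], t2 := []
      fl := [], cl := [] })
    (by simp) (by simp) (by simp)
  simp only [st_fam, update_st_fam2] at h1
  have h2 := (segRuns_scan_clauses { ρ with fam := formW φ } L (formW φ).length φ.clauses
    (fun c hc l hl => length_rbits_le φ hc hl) none []).runs_loop_nil (by simp)
  simp only [List.append_nil, Option.isSome_none, Bool.false_eq_true, flagW_false _ not_false, stagedW,
    Option.none_or, ← viol_eq_find] at h2
  refine (h1.seq h2).of_eq rfl ?_
  simp only [formW]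
  nlinarith

end Literature.Computability.FineGrained.SchoeningCoin
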